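import Summits.BirchSwinnertonDyer.BirchSwinnertonDyer.Theorems.PrintX11aUpperNonSurjFiveExcPeriod
import HarnessLib

/-!
# Crux U5 `PrintX11a.UpperNonSurjFive` (item stmt-BirchSwinnertonDyer-20614), line «gl1cartan5», EXCEPTIONAL-ZERO road:
# a normalised plus symbol which is a unit on one PATH is a unit on one CYCLE (any level, one non-Eisenstein prime
# `r ≡ 1 (mod N)`), general `p`

Cell `bsd-print-x11a`, seat `cruxlead-stmt-BirchSwinnertonDyer-20614` (LEAD g6); `--supports stmt-BirchSwinnertonDyer-20614`,
closes nothing. File 4b of the EXCEPTIONAL-ZERO road. Vatsal's fact (`vatsal1999_plusSymbol_congruence` /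
`greenbergVatsal2000_plusSymbol_congruence`) hands the consumer a normalisation `Ω_f` of the plus symbol of an eigenform that is
integral on every path `{∞, x}` and a UNIT on SOME path `{∞, x₁}`, `x₁ ∈ ℚ` arbitrary (Vatsal Remark (1.12)). The exceptional-zero
core compares `Ω_f` with the lattice period `Ω⁺_f` of the newform `f` of an elliptic curve through a point where `plusSymbol f/Ω_f`
is a unit AND `[·]⁺_f` is known to be `p`-integral; on a CYCLE `{∞, γ∞}` (`γ ∈ Γ₀(N)`) the latter is free (`[γ∞]⁺_f ∈ ½ℤ` by the
definition of `Ω⁺_f`, see `…ExcCoreCycle`). THIS FILE moves the unit from a path to a cycle: same boundary argument as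
`…ExcPeriod.exists_period_integral_unit_cycle_sum_smul_of_one_mod` (if every cycle value lies in `𝔪` the reduced symbol is constant
on `Γ₀(N)`-cusp classes, and the Hecke relation at a prime `r ≡ 1 (mod N)` with `a_r − r − 1` a unit kills it), but with the
normalisation `Ω` GIVEN instead of constructed. Theorems only; no definition, no named fact, no `sorry`; BSD is not proved by this.

* `exists_unit_cycle_of_unit_path_sum_smul_of_one_mod` (family `Σ cᵢ φᵢ`), `exists_unit_cycle_of_unit_path_of_one_mod` (one form).

## References

* V. Vatsal, Duke Math. J. 98 (1999), §1 (1.5)–(1.6), Remark (1.12) [Vatsal1999]; J. E. Cremona (1997), §2.2–§2.3, §2.8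
  [CremonaAlgorithms1997]; F. Diamond, J. Shurman (2005), §3.8 [DiamondShurman2005].
-/

set_option autoImplicit false
-- the Theorems namespace of a single-conjunct summit repeats the summit name by design (D-0017)
set_option linter.dupNamespace false

noncomputable section

open scoped MatrixGroups ModularForm Classical NNReal

open CongruenceSubgroup WeierstrassCurve Literature.NumberTheory.EllipticCurves
  Literature.NumberTheory.EllipticCurves.ModularForms ModularGroup
open UpperHalfPlane hiding I

namespace Summit.BirchSwinnertonDyer.BirchSwinnertonDyer.Theorems.GL1Cartan.Exc

open Summit.BirchSwinnertonDyer.BirchSwinnertonDyer.Theorems.KimAtThreeDeepLowerOffStratumLevelLoweringStabEigenform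
  (smul_plusSymbol_of_heckeT)
open Summit.BirchSwinnertonDyer.BirchSwinnertonDyer.Theorems.KimAtThreeDeepLowerOffStratumLevelLoweringCanonicalPeriod
  (exists_sl_apply_eq_num_den)
open Summit.BirchSwinnertonDyer.BirchSwinnertonDyer.Theorems.KimAtThreeDeepLowerOffStratumLevelLoweringMultiStabPeriod
  (plusSymbol_sum_smul plusSymbol_sum_smul_eq plusSymbol_sum_smul_eq_re)
open Summit.BirchSwinnertonDyer.BirchSwinnertonDyer.Theorems.KimAtThreeDeepLowerOffStratumLevelLoweringMultiStabPeriodAnyLevel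
  (exists_plusSymbol_sum_smul_eq_sub_of_cuspOrbitOf_eq cuspOrbitOf_numDen_div_prime_eq cuspOrbitOf_numDen_prime_mul_eq)

section Cycle

variable {p : ℕ} [Fact p.Prime] {N : ℕ} [NeZero N] {I : Type*} [Fintype I] {φ : I → CuspForm (Gamma0 N) 2} (c : I → ℂ)

/-- ★ **Unit on a path ⟹ unit on a cycle.** Let `φᵢ ∈ S₂(Γ₀(N))` have REAL coefficients, `G = Σ cᵢ φᵢ`, `Ω ∈ ℂ` with
`plusSymbol G x/Ω` `p`-integral for every `x ∈ ℚ` and a UNIT at some `x₁ ∈ ℚ`, and let `r ≡ 1 (mod N)` be a prime (`r ∤ N`)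
with `T_r G = a·G`, `a` integral, `a − r − 1` a unit. Then `plusSymbol G (γ₀∞)/Ω` is a unit for some `γ₀ ∈ Γ₀(N)` with
`γ₀∞ ≠ ∞`. (Else the reduced symbol `ψ = (plusSymbol G/Ω mod 𝔪)` kills every cycle, so it is constant on `Γ₀(N)`-cusp
classes — Manin: same class ⟹ the two paths differ by a cycle —, the `r + 1` cusps `(x + j)/r`, `rx` of `T_r{∞, x}` lie in the
class of `x` as `r ≡ 1 (mod N)`, and the Hecke relation reads `(a − r − 1)ψ(x) = 0`: `ψ ≡ 0`, contradicting `ψ(x₁) ≠ 0`.)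
[cite: Vatsal1999, §1 (1.5)–(1.6), Remark (1.12)] [cite: CremonaAlgorithms1997, §2.3 and §2.8] [cite: DiamondShurman2005, §3.8] -/
theorem exists_unit_cycle_of_unit_path_sum_smul_of_one_mod (ι : PadicAlgCl p ≃+* ℂ)
    (hreal : ∀ i n, (cuspCoeff (φ i) n).im = 0) {Ω : ℂ}
    (hint : ∀ x : ℚ, Valued.v (ι.symm (plusSymbol (∑ i, c i • φ i) x / Ω)) ≤ 1)
    (hx₁ : ∃ x₁ : ℚ, Valued.v (ι.symm (plusSymbol (∑ i, c i • φ i) x₁ / Ω)) = 1)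
    {r : ℕ} (hr : r.Prime) (hrM : ¬ r ∣ N) (hr1 : r ≡ 1 [MOD N]) {a : ℂ} (ha : Valued.v (ι.symm a) ≤ 1)
    (hT : (haveI : NeZero r := ⟨hr.ne_zero⟩; heckeT (Gamma0 N) 2 r (∑ i, c i • φ i)) = a • ∑ i, c i • φ i)
    (hE : Valued.v (ι.symm (a - (r + 1))) = 1) :
    ∃ γ₀ : Gamma0 N, (γ₀ : SL(2, ℤ)) 1 0 ≠ 0 ∧
      Valued.v (ι.symm (plusSymbol (∑ i, c i • φ i)
        ((((γ₀ : SL(2, ℤ)) 0 0 : ℤ) : ℚ) / (((γ₀ : SL(2, ℤ)) 1 0 : ℤ) : ℚ)) / Ω)) = 1 := by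
  classical
  haveI := charP_residueField (p := p)
  haveI : NeZero r := ⟨hr.ne_zero⟩
  set res := IsLocalRing.residue (Valued.integer (PadicAlgCl p)) with hres
  set G := ∑ i, c i • φ i with hG
  set Ψk : SL(2, ℤ) → ℂ := fun k ↦ ∑ i, c i * (((inftySymbol (φ i) k).re : ℝ) : ℂ) with hΨk
  have hΨk_of_ne : ∀ k : SL(2, ℤ), k 1 0 ≠ 0 → Ψk k = plusSymbol G (((k 0 0 : ℤ) : ℚ) / ((k 1 0 : ℤ) : ℚ)) := by
    intro k hk
    simp only [hΨk, inftySymbol, if_neg hk, hG]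
    rw [plusSymbol_sum_smul_eq_re φ c hreal]
  have hΨk_of_eq : ∀ k : SL(2, ℤ), k 1 0 = 0 → Ψk k = 0 := by
    intro k hk
    simp only [hΨk, inftySymbol, if_pos hk, Complex.zero_re, Complex.ofReal_zero, mul_zero, Finset.sum_const_zero]
  by_contra H
  push Not at H
  have hcyc : ∀ γ : Gamma0 N, ‖ι.symm (Ψk γ / Ω)‖ < 1 := by
    intro γ
    by_cases h0 : (γ : SL(2, ℤ)) 1 0 = 0
    · rw [hΨk_of_eq _ h0, zero_div, map_zero, norm_zero]
      exact zero_lt_one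
    · have hγ := H γ h0
      rw [hΨk_of_ne _ h0]
      have h1' := hint ((((γ : SL(2, ℤ)) 0 0 : ℤ) : ℚ) / (((γ : SL(2, ℤ)) 1 0 : ℤ) : ℚ))
      rw [valuation_le_one_iff] at h1'
      rw [Ne, valuation_eq_one_iff] at hγ
      exact lt_of_le_of_ne h1' hγ
  have mX : ∀ x : ℚ, ι.symm (plusSymbol G x / Ω) ∈ Valued.integer (PadicAlgCl p) := fun x ↦
    mem_integer_iff_norm_le_one.mpr (valuation_le_one_iff.mp (hint x))
  let ψ : ℚ → IsLocalRing.ResidueField (Valued.integer (PadicAlgCl p)) := fun x ↦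
    res ⟨ι.symm (plusSymbol G x / Ω), mX x⟩
  -- (E) `ψ` is constant on `Γ₀(N)`-cusp classes (ANY level)
  have hE' : ∀ (x y : ℚ) (kx ky : SL(2, ℤ)), kx 0 0 = x.num → kx 1 0 = x.den → ky 0 0 = y.num → ky 1 0 = y.den →
      cuspOrbitOf N ky = cuspOrbitOf N kx → ψ y = ψ x := by
    intro x y kx ky hx0 hx1 hy0 hy1 horb
    obtain ⟨γ, hγ⟩ := exists_plusSymbol_sum_smul_eq_sub_of_cuspOrbitOf_eq φ c hreal hx0 hx1 hy0 hy1 horb.symm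
    have hγ' : plusSymbol G y = plusSymbol G x - Ψk γ := by
      rw [hG, hγ, hΨk]
      simp only [cuspSymbol_eq_inftySymbol]
    have mγ : ι.symm (Ψk γ / Ω) ∈ Valued.integer (PadicAlgCl p) := mem_integer_iff_norm_le_one.mpr (hcyc γ).le
    have hO : (⟨ι.symm (plusSymbol G y / Ω), mX y⟩ : Valued.integer (PadicAlgCl p)) =
        ⟨ι.symm (plusSymbol G x / Ω), mX x⟩ - ⟨ι.symm (Ψk γ / Ω), mγ⟩ := by
      apply Subtype.ext
      push_cast
      rw [← map_sub, hγ', sub_div]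
    show res _ = res _
    rw [hO, map_sub, residue_mk_eq_zero_of_norm_lt_one mγ (hcyc γ), sub_zero]
  have hEdiv : ∀ (x : ℚ) (j : ℤ), ψ ((x + j) / r) = ψ x := by
    intro x j
    obtain ⟨kx, hx0, hx1⟩ := exists_sl_apply_eq_num_den x
    obtain ⟨ky, hy0, hy1⟩ := exists_sl_apply_eq_num_den ((x + j) / r)
    exact hE' x _ kx ky hx0 hx1 hy0 hy1 (cuspOrbitOf_numDen_div_prime_eq hr hr1 x j hx0 hx1 hy0 hy1)
  have hEmul : ∀ x : ℚ, ψ ((r : ℚ) * x) = ψ x := by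
    intro x
    obtain ⟨kx, hx0, hx1⟩ := exists_sl_apply_eq_num_den x
    obtain ⟨ky, hy0, hy1⟩ := exists_sl_apply_eq_num_den ((r : ℚ) * x)
    exact hE' x _ kx ky hx0 hx1 hy0 hy1 (cuspOrbitOf_numDen_prime_mul_eq hr hr1 x hx0 hx1 hy0 hy1)
  -- (F) the Hecke relation of `G` at `r` kills `ψ`
  have ma : ι.symm a ∈ Valued.integer (PadicAlgCl p) := mem_integer_iff_norm_le_one.mpr (valuation_le_one_iff.mp ha)
  have hunit : res ⟨ι.symm a, ma⟩ - ((r : IsLocalRing.ResidueField (Valued.integer (PadicAlgCl p))) + 1) ≠ 0 := by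
    have mE : ι.symm (a - (r + 1)) ∈ Valued.integer (PadicAlgCl p) :=
      mem_integer_iff_norm_le_one.mpr (valuation_eq_one_iff.mp hE).le
    have heq : (⟨ι.symm (a - (r + 1)), mE⟩ : Valued.integer (PadicAlgCl p)) =
        ⟨ι.symm a, ma⟩ - ((r : Valued.integer (PadicAlgCl p)) + 1) := by
      apply Subtype.ext
      push_cast
      rw [map_sub, map_add, map_natCast, map_one]
    have h : res ⟨ι.symm (a - (r + 1)), mE⟩ =
        res ⟨ι.symm a, ma⟩ - ((r : IsLocalRing.ResidueField (Valued.integer (PadicAlgCl p))) + 1) := by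
      rw [heq, map_sub res, map_add res, map_natCast res, map_one res]
    rw [← h, Ne, IsLocalRing.residue_eq_zero_iff, IsLocalRing.mem_maximalIdeal, mem_nonunits_iff, not_not,
      Valuation.Integers.isUnit_iff_valuation_eq_one (Valuation.integer.integers _)]
    exact hE
  have hF : ∀ x : ℚ, ψ x = 0 := by
    intro x
    have hH := smul_plusSymbol_of_heckeT r hr hrM hT x
    have hO : (⟨ι.symm a, ma⟩ : Valued.integer (PadicAlgCl p)) * ⟨ι.symm (plusSymbol G x / Ω), mX x⟩ =
        (∑ j : Fin r, ⟨ι.symm (plusSymbol G ((x + j) / r) / Ω), mX ((x + j) / r)⟩) +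
          ⟨ι.symm (plusSymbol G (r * x) / Ω), mX (r * x)⟩ := by
      apply Subtype.ext
      push_cast
      rw [← map_mul, ← map_sum, ← map_add]
      congr 1
      rw [mul_div_assoc', hG, hH, add_div, Finset.sum_div]
    have h := congrArg res hO
    rw [map_mul, map_add, map_sum] at h
    have hj : ∀ j : Fin r, res ⟨ι.symm (plusSymbol G ((x + j) / r) / Ω), mX ((x + j) / r)⟩ = ψ x := by
      intro j
      have e : (x + (j : ℚ)) = x + ((j : ℕ) : ℤ) := by push_cast; rfl
      have := hEdiv x ((j : ℕ) : ℤ)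
      rw [← e] at this
      exact this
    have hrx : res ⟨ι.symm (plusSymbol G (r * x) / Ω), mX (r * x)⟩ = ψ x := hEmul x
    simp only [hj, hrx, Finset.sum_const, Finset.card_univ, Fintype.card_fin, nsmul_eq_mul] at h
    have hψ : (res ⟨ι.symm a, ma⟩ -
        ((r : IsLocalRing.ResidueField (Valued.integer (PadicAlgCl p))) + 1)) * ψ x = 0 := by
      rw [sub_mul, add_mul, one_mul, h, sub_self]
    exact (mul_eq_zero.mp hψ).resolve_left hunit
  obtain ⟨x₁, hx₁⟩ := hx₁
  have h1' : ψ x₁ ≠ 0 := by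
    show res _ ≠ 0
    rw [Ne, IsLocalRing.residue_eq_zero_iff, IsLocalRing.mem_maximalIdeal, mem_nonunits_iff, not_not,
      Valuation.Integers.isUnit_iff_valuation_eq_one (Valuation.integer.integers _)]
    exact hx₁
  exact h1' (hF x₁)

/-- **The single-form case**: for `F ∈ S₂(Γ₀(N))` with real coefficients (`I = Unit`, `c = 1`). [cite: Vatsal1999, §1 Remark (1.12)] -/
theorem exists_unit_cycle_of_unit_path_of_one_mod (ι : PadicAlgCl p ≃+* ℂ) {F : CuspForm (Gamma0 N) 2}
    (hreal : ∀ n, (cuspCoeff F n).im = 0) {Ω : ℂ}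
    (hint : ∀ x : ℚ, Valued.v (ι.symm (plusSymbol F x / Ω)) ≤ 1)
    (hx₁ : ∃ x₁ : ℚ, Valued.v (ι.symm (plusSymbol F x₁ / Ω)) = 1)
    {r : ℕ} (hr : r.Prime) (hrM : ¬ r ∣ N) (hr1 : r ≡ 1 [MOD N]) {a : ℂ} (ha : Valued.v (ι.symm a) ≤ 1)
    (hT : (haveI : NeZero r := ⟨hr.ne_zero⟩; heckeT (Gamma0 N) 2 r F) = a • F)
    (hE : Valued.v (ι.symm (a - (r + 1))) = 1) :
    ∃ γ₀ : Gamma0 N, (γ₀ : SL(2, ℤ)) 1 0 ≠ 0 ∧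
      Valued.v (ι.symm (plusSymbol F ((((γ₀ : SL(2, ℤ)) 0 0 : ℤ) : ℚ) / (((γ₀ : SL(2, ℤ)) 1 0 : ℤ) : ℚ)) / Ω)) = 1 := by
  have hsum : (∑ i : Unit, (fun _ : Unit ↦ (1 : ℂ)) i • (fun _ : Unit ↦ F) i) = F := by simp
  have h := exists_unit_cycle_of_unit_path_sum_smul_of_one_mod (φ := fun _ : Unit ↦ F) (fun _ ↦ (1 : ℂ)) ι
    (fun _ n ↦ hreal n) (Ω := Ω) (by rw [hsum]; exact hint) (by rw [hsum]; exact hx₁) hr hrM hr1 ha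
    (by rw [hsum]; exact hT) hE
  rw [hsum] at h
  exact h

end Cycle

end Summit.BirchSwinnertonDyer.BirchSwinnertonDyer.Theorems.GL1Cartan.Exc

end
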